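import Summits.Ventures.WeilGRH.UniformConductorFloorLog12TableValidA
import HarnessLib

/-!
# GRH arm (rh-explicit, venture WeilGRH): the special-value table at `a = (log 12)/2` — validity of the records of the modes `60 … 79`
  (kernel certificates, part D of eight)

Cell `rh-explicit`, WEIL TRACK — GRH ARM (weil-grh-1, gen9).  `checkTable` slice `[60, 80)` of `UniformConductorFloorLog12Table.lean` (recompute
`Encl.idxRec` at every mode, test containment; ≈ 100 s), glued into `tab_valid` in `UniformConductorFloorLog12TableValid.lean` (gen10: parts B–G import part A only and file in parallel).
No definitions; no named facts; standard axioms. [cite: Moore1966, Ch. 3 (interval arithmetic: inclusion property)]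
-/

set_option maxRecDepth 200000

namespace Summit.Ventures.WeilGRH.Log12Table
open Literature.NumberTheory.LFunctions Literature.NumberTheory.LFunctions.Yoshida1992 Encl Literature.Analysis.ValidatedNumerics.NumericsMP

/-- kernel: table slice `[60, 80)`. [cite: Moore1966, Ch. 3 (interval arithmetic: inclusion property)] -/
theorem tT60 : checkTable prm C tab 60 20 = true := by decide +kernel


end Summit.Ventures.WeilGRH.Log12Table
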